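import Summits.QuantumFields.BalabanUV.T4Continuum.Support.NE7QbarLipschitzTower
import Summits.QuantumFields.BalabanUV.T4Continuum.Support.NE7FlatSkewSliceSolvable
import Summits.QuantumFields.BalabanUV.T4Continuum.Support.NE7FlatSkewSlice
import Summits.QuantumFields.BalabanUV.T4Continuum.Support.NE3FramePotBound
import Summits.QuantumFields.BalabanUV.T4Continuum.Support.NE3SmoothRightInverseCurl
import Summits.QuantumFields.BalabanUV.T4Continuum.Support.AveragingDeficitPeriodicCounting
import HarnessLib

/-!
# NE7FramePotL1 — THE FRAME POTENTIAL IN `ℓ¹` AND THE CORNER GAUGE CORRECTOR: every skew periodic field whose straight `(k+1)`-fold block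
# average VANISHES is, up to a pure gauge supported at the top block corners (cost `C_F(d,L)·‖·‖₁`, `k`-UNIFORM), a skew periodic TANGENT direction
# at the flat background with the same curl

Cell `pub-balaban`, rung (B)+1 sub-cell t4, lineage `b2b-balaban-t4-ne7-p1`, generation 72 (CRUX PROVER NE7 #1).  File G2 of the G♭ discharge (sequel of
G1 `NE7SliceGreenTorus`; consumed by G3, the T4 transfer).
WHY.  The slice solver letter G♭ of the END F55 is stated on the T4 TANGENT space `T = ker dirIter L (k+1) 1` of the flat background, which is NOT the kernel
of the straight block average: `(Tcoarse L)^[k+1] Y = (Qcoarse L)^[k+1] Y − dPot (framePot L (k+1) Y)` (row NE3 `NE3TangentFlatStructure.iterate_Tcoarse_eq`;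
memo H15 §1: the frames funnel through the block corners).  G1's torus theorem produces its test fields in `ker Q_k` (straight average zero); to feed the
T4 hypothesis they must be made TANGENT.  The cheap way (memo of this generation): add the pure gauge `dPot Λ` with `Λ` supported at the top corners
`L^{k+1}ℤ^d`, `Λ(L^{k+1}z) = framePot L (k+1) Y z` — then `(Tcoarse L)^[k+1](dPot Λ) = dPot (Λ ∘ (L^{k+1}•)) = dPot (framePot Y)` cancels the frame term
(`Tcoarse_dPot` iterated), the curl is unchanged, and the `ℓ¹` cost is `2d·Σ_{z∈[0,N)^d} ‖framePot L (k+1) Y z‖`.  THIS FILE bounds that sum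
(**`sum_norm_framePot_le`**: `≤ C_F·‖Y‖_{ℓ¹([0,L^{k+1}N)^d)}`, `C_F = 2dL(2dL+1)^d`, uniformly in `k` and `N` — the closed form `framePot_eq_sum`, the one-frame
box bound `NE3FramePotBound.norm_Fcoarse_le`, torus box counting `AveragingDeficitPeriodicCounting.sum_periodBox_box_le`, F50's flat tower norm
`NE7QbarLipschitzTower.sum_norm_iterate_Qcoarse_le` (`‖Q^{(m)}‖_{ℓ¹→ℓ¹} ≤ (L∕L^d)^m`) and the geometric sum) and packages the corrector
(**`exists_tangent_of_straight_zero`**: the corrected field, skew-symmetrised by p2's `skewPart`, is skew, periodic, tangent, has the same flat curl, and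
`‖·‖₁ ≤ (1 + 2d·C_F)·‖Y‖₁`).
WHAT ([folklore]; 0 def, 0 sorry; general dimension `d ≥ 2`, `L ≥ 2`).  §1 `iterate_Tcoarse_dPot`; §2 `sum_norm_framePot_le`; §3 `exists_tangent_of_straight_zero`.
HONEST FRAMING (page 1): lattice bookkeeping of the LINEARISED average at the FLAT configuration; nothing of Bałaban's asserted; NOT (APE), NOT ONE-STEP,
NOT NE7; spine 0∕9; finite T⁴ rung (B)+1 — NOT infinite volume, NOT mass gap, NOT Clay.  Continuum YM on T⁴ ⇐ BetaPertH ∧ nine spine estimates (0/9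
proved); BetaPertH ⇐ (D1) ∧ (D4) ∧ CAP+tail; G-an2-4 gates asym, D1 and NE2/3/4.
-/

set_option autoImplicit false

open scoped BigOperators Matrix Matrix.Norms.L2Operator
open Finset

namespace Summit.QuantumFields.BalabanUV.T4Continuum.NE7FramePotL1

open Literature.MathematicalPhysics.QuantumFieldTheory.Balaban1983to89
open B7Prop1Explicit (Site e e_apply boxVec)
open T4AveragingDeficitWall (IsUnitaryCfg IsSkewDir curlAt dirL1 box)
open T4AveragingDeficitWallBoundary (periodBox mem_periodBox sum_blocks_eq blockSites_periodBox sum_periodBox_shift)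
open AveragingDeficitPeriodicCounting (IsPeriodicDir sum_periodBox_box_le)
open BlockAveragePushDirSplit (flat)
open SmoothRefineNeutral (Tcoarse)
open NE3TangentNoGoWords (dPot)
open NE3TangentFlatStructure (Qcoarse Fcoarse framePot iterate_Tcoarse_eq' Tcoarse_dPot framePot_add_period iterate_Qcoarse_add_period
  dPot_add_period)
open NE3TangentCovariantTower (dirIter dirIter_flat)
open NE3FramePotBound (framePot_eq_sum norm_Fcoarse_le isUnitaryCfg_flat geom_sum_le_inv)
open NE3SmoothRightInverseFlat (iterate_Tcoarse_add)
open NE3SmoothRightInverseCurl (curlAt_flat_dPot curlAt_flat_add)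
open NE3HessBounds (curlAt_mem_skewAdjoint)
open NE7QbarLipschitzTower (sum_norm_iterate_Qcoarse_le)
open NE7FlatSkewSlice (skewPart skewPartM_zero' isSkewDir_skewPart isPeriodicDir_skewPart norm_skewPart_le curlAt_flat_skewPart skewPartM_eq_self
  dirIter_flat_skewPart)
open NE7FlatSkewSliceSolvable (dirIter_flat_add)

noncomputable section

variable {d : ℕ} {n : Type*} [Fintype n] [DecidableEq n]

/-! ## §1 The iterated contour average of a pure gauge -/

/-- **`(Tcoarse L)^[j] (dPot Φ) = dPot (Φ ∘ (L^j•))`** — the contour average of an exact cochain is the coboundary of its corner values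
(`NE3TangentFlatStructure.Tcoarse_dPot` iterated). [folklore] -/
theorem iterate_Tcoarse_dPot {L : ℕ} (hL : 1 ≤ L) : ∀ (j : ℕ) (Φ : Site d → Matrix n n ℂ),
    (Tcoarse L)^[j] (dPot Φ) = dPot (fun w => Φ (((L : ℤ) ^ j) • w))
  | 0, Φ => by simp
  | j + 1, Φ => by
      rw [Function.iterate_succ_apply]
      have h1 : Tcoarse L (dPot Φ) = dPot (fun w => Φ ((L : ℤ) • w)) := funext fun z => funext fun κ => Tcoarse_dPot hL Φ z κ
      rw [h1, iterate_Tcoarse_dPot hL j]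
      congr 1
      funext w
      rw [smul_smul, ← pow_succ']

/-! ## §2 The frame potential in `ℓ¹` over the coarse period box, `k`-uniformly -/

/-- **`Σ_{z∈[0,N)^d} ‖framePot L (k+1) Y z‖ ≤ C_F·‖Y‖_{ℓ¹([0,L^{k+1}N)^d)}`, `C_F = 2dL(2dL+1)^d`** for an `(L^{k+1}N)`-periodic `Y` (`d ≥ 2`, `L ≥ 2`).
PROOF: the closed form `framePot (k+1) Y z = Σ_{m≤k} Fcoarse L (Q^{(m)}Y) (L^{k−m}•z)`; one frame costs `dL·‖Q^{(m)}Y‖_{ℓ¹(box dL (L^{k+1−m}•z))}`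
(`norm_Fcoarse_le`); the boxes around the sparse sites `L^{k+1−m}•z` overlap at most `(2dL+1)^d` times on the level-`m` torus (`sum_periodBox_box_le`);
`‖Q^{(m)}Y‖₁ ≤ (L∕L^d)^m‖Y‖₁` (F50); `Σ_m (L∕L^d)^m ≤ 2`. [folklore] -/
theorem sum_norm_framePot_le [Nonempty n] (hd : 2 ≤ d) {L : ℕ} (hL : 2 ≤ L) (k : ℕ) {N : ℕ} (hN : 1 ≤ N)
    {Y : Site d → Fin d → Matrix n n ℂ} (hY : IsPeriodicDir Y ((L ^ (k + 1) * N : ℕ) : ℤ)) :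
    ∑ z ∈ periodBox N, ‖framePot L (k + 1) Y z‖
      ≤ (2 * ((d : ℝ) * L) * ((2 * (d * L) + 1 : ℕ) : ℝ) ^ d) * dirL1 Y (periodBox (L ^ (k + 1) * N)) := by
  have hL1 : 1 ≤ L := by omega
  have hLr : (2 : ℝ) ≤ L := by exact_mod_cast hL
  set q : ℝ := (L : ℝ) / (L : ℝ) ^ d with hq
  have hq0 : 0 ≤ q := by positivity
  have hq1 : q ≤ 1 / 2 := by
    rw [hq, div_le_iff₀ (by positivity)]
    obtain ⟨d', rfl⟩ : ∃ d', d = d' + 2 := ⟨d - 2, by omega⟩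
    have h1 : (1 : ℝ) ≤ (L : ℝ) ^ d' := one_le_pow₀ (by linarith)
    rw [pow_add, pow_two]
    nlinarith [mul_le_mul h1 hLr (by norm_num) (by positivity)]
  have hq1' : q < 1 := by linarith
  have hD0 : 0 ≤ dirL1 Y (periodBox (d := d) (L ^ (k + 1) * N)) :=
    Finset.sum_nonneg fun _ _ => Finset.sum_nonneg fun _ _ => norm_nonneg _
  -- the level-`m` term, summed over the coarse period box
  have hterm : ∀ m ∈ Finset.range (k + 1),
      ∑ z ∈ periodBox N, ‖Fcoarse L ((Qcoarse L)^[m] Y) (((L : ℤ) ^ (k + 1 - 1 - m)) • z)‖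
        ≤ ((d : ℝ) * L) * ((2 * (d * L) + 1 : ℕ) : ℝ) ^ d * (q ^ m * dirL1 Y (periodBox (L ^ (k + 1) * N))) := by
    intro m hm
    have hmk : m ≤ k := Nat.lt_succ_iff.mp (Finset.mem_range.mp hm)
    -- the period of `Q^{(m)}Y` is `L^{k+1−m}·N`
    have hP : L ^ (k + 1) * N = L ^ m * (L ^ (k + 1 - m) * N) := by
      rw [← mul_assoc, ← pow_add, show m + (k + 1 - m) = k + 1 by omega]
    have hYm : IsPeriodicDir Y (((L ^ m * (L ^ (k + 1 - m) * N) : ℕ) : ℤ)) := by rw [← hP]; exact hY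
    have hQper : ∀ (x : Site d) (τ κ : Fin d),
        (Qcoarse L)^[m] Y (x + (((L ^ (k + 1 - m) * N : ℕ) : ℤ)) • e τ) κ = (Qcoarse L)^[m] Y x κ :=
      iterate_Qcoarse_add_period L m Y (P := ((L ^ (k + 1 - m) * N : ℕ) : ℤ)) (fun y τ μ => by
        have := hYm y τ μ; push_cast at this ⊢; exact this)
    have hNm : 1 ≤ L ^ (k + 1 - m) * N := Nat.one_le_iff_ne_zero.mpr (Nat.mul_ne_zero (pow_ne_zero _ (by omega)) (by omega))
    -- one frame against its box, then the box counting on the level-`m` torus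
    have hexp : (k + 1 - 1 - m) = k - m := by omega
    calc ∑ z ∈ periodBox N, ‖Fcoarse L ((Qcoarse L)^[m] Y) (((L : ℤ) ^ (k + 1 - 1 - m)) • z)‖
        ≤ ∑ z ∈ periodBox N, ((d : ℝ) * L) * dirL1 ((Qcoarse L)^[m] Y) (box (d * L) (((L ^ (k + 1 - m) : ℕ) : ℤ) • z)) := by
          refine Finset.sum_le_sum fun z _ => ?_
          have h := norm_Fcoarse_le (d := d) (n := n) hL1 ((Qcoarse L)^[m] Y) (((L : ℤ) ^ (k + 1 - 1 - m)) • z)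
          rw [smul_smul, ← pow_succ', hexp, show k - m + 1 = k + 1 - m by omega] at h
          push_cast
          exact h
      _ = ((d : ℝ) * L) * ∑ z ∈ periodBox N, ∑ x ∈ box (d * L) (((L ^ (k + 1 - m) : ℕ) : ℤ) • z), ∑ κ : Fin d, ‖(Qcoarse L)^[m] Y x κ‖ := by
          rw [Finset.mul_sum]; rfl
      _ ≤ ((d : ℝ) * L) * ((2 * (d * L) + 1 : ℕ) ^ d * ∑ x ∈ periodBox (L ^ (k + 1 - m) * N), ∑ κ : Fin d, ‖(Qcoarse L)^[m] Y x κ‖) := by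
          refine mul_le_mul_of_nonneg_left ?_ (by positivity)
          have h := sum_periodBox_box_le (d := d) (L ^ (k + 1 - m)) N (Nat.one_le_pow _ _ (by omega)) hN (d * L)
            (g := fun x => ∑ κ : Fin d, ‖(Qcoarse L)^[m] Y x κ‖) (fun _ => Finset.sum_nonneg fun _ _ => norm_nonneg _)
            (fun x τ => Finset.sum_congr rfl fun κ _ => by rw [hQper x τ κ])
          exact_mod_cast h
      _ ≤ ((d : ℝ) * L) * ((2 * (d * L) + 1 : ℕ) ^ d * (q ^ m * dirL1 Y (periodBox (L ^ (k + 1) * N)))) := by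
          refine mul_le_mul_of_nonneg_left (mul_le_mul_of_nonneg_left ?_ (by positivity)) (by positivity)
          have h := sum_norm_iterate_Qcoarse_le (d := d) (n := n) hL1 m hNm Y hYm
          rw [← hP] at h
          exact h
      _ = _ := by push_cast; ring
  -- assemble
  calc ∑ z ∈ periodBox N, ‖framePot L (k + 1) Y z‖
      = ∑ z ∈ periodBox N, ‖∑ m ∈ Finset.range (k + 1), Fcoarse L ((Qcoarse L)^[m] Y) (((L : ℤ) ^ (k + 1 - 1 - m)) • z)‖ := by
        refine Finset.sum_congr rfl fun z _ => ?_
        rw [framePot_eq_sum]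
    _ ≤ ∑ z ∈ periodBox N, ∑ m ∈ Finset.range (k + 1), ‖Fcoarse L ((Qcoarse L)^[m] Y) (((L : ℤ) ^ (k + 1 - 1 - m)) • z)‖ :=
        Finset.sum_le_sum fun z _ => norm_sum_le _ _
    _ = ∑ m ∈ Finset.range (k + 1), ∑ z ∈ periodBox N, ‖Fcoarse L ((Qcoarse L)^[m] Y) (((L : ℤ) ^ (k + 1 - 1 - m)) • z)‖ := Finset.sum_comm
    _ ≤ ∑ m ∈ Finset.range (k + 1), ((d : ℝ) * L) * ((2 * (d * L) + 1 : ℕ) : ℝ) ^ d * (q ^ m * dirL1 Y (periodBox (L ^ (k + 1) * N))) :=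
        Finset.sum_le_sum hterm
    _ = ((d : ℝ) * L) * ((2 * (d * L) + 1 : ℕ) : ℝ) ^ d * ((∑ m ∈ Finset.range (k + 1), q ^ m) * dirL1 Y (periodBox (L ^ (k + 1) * N))) := by
        rw [← Finset.mul_sum, Finset.sum_mul]
    _ ≤ ((d : ℝ) * L) * ((2 * (d * L) + 1 : ℕ) : ℝ) ^ d * (2 * dirL1 Y (periodBox (L ^ (k + 1) * N))) := by
        refine mul_le_mul_of_nonneg_left (mul_le_mul_of_nonneg_right ?_ hD0) (by positivity)
        calc ∑ m ∈ Finset.range (k + 1), q ^ m ≤ 1 / (1 - q) := geom_sum_le_inv hq0 hq1' (k + 1)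
          _ ≤ 2 := by rw [div_le_iff₀ (by linarith)]; linarith
    _ = _ := by ring

/-! ## §3 The corner gauge corrector: straight average zero ⟹ tangent up to a cheap pure gauge -/

/-- **A SKEW PERIODIC FIELD WITH VANISHING STRAIGHT `(k+1)`-FOLD AVERAGE IS TANGENT UP TO A CORNER GAUGE** (`d ≥ 2`, `L ≥ 2`, `N ≥ 1`): for `Y₁` skew,
`(L^{k+1}N)`-periodic with `(Qcoarse L)^[k+1] Y₁ = 0` there is `Y` skew, `(L^{k+1}N)`-periodic, with `dirIter L (k+1) 1 Y = 0`, the SAME flat curl, and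
`‖Y‖_{ℓ¹([0,L^{k+1}N)^d)} ≤ (1 + 2d·C_F)·‖Y₁‖_{ℓ¹}`.  Construction: `Y = skewPart (Y₁ + dPot Λ)`, `Λ(x) = framePot L (k+1) Y₁ (x∕L^{k+1})` at the top
corners `x ∈ L^{k+1}ℤ^d`, `0` elsewhere (§1 cancels the frame term of `iterate_Tcoarse_eq`; p2's `skewPart` restores skewness and commutes with the flat
average and curl; the gauge costs `2d·Σ_z‖framePot Y₁ z‖ ≤ 2d·C_F‖Y₁‖₁` by §2). [folklore] -/
theorem exists_tangent_of_straight_zero [Nonempty n] (hd : 2 ≤ d) {L : ℕ} (hL : 2 ≤ L) (k : ℕ) {N : ℕ} (hN : 1 ≤ N)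
    {Y₁ : Site d → Fin d → Matrix n n ℂ} (hY₁s : IsSkewDir Y₁) (hY₁P : IsPeriodicDir Y₁ ((L ^ (k + 1) * N : ℕ) : ℤ))
    (hQ : (Qcoarse L)^[k + 1] Y₁ = 0) :
    ∃ Y : Site d → Fin d → Matrix n n ℂ, IsSkewDir Y ∧ IsPeriodicDir Y ((L ^ (k + 1) * N : ℕ) : ℤ) ∧
      dirIter L (k + 1) (flat (d := d) (n := n)) Y = 0 ∧
      (∀ (z : Site d) (μ ν : Fin d), curlAt (flat (d := d) (n := n)) Y z μ ν = curlAt (flat (d := d) (n := n)) Y₁ z μ ν) ∧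
      dirL1 Y (periodBox (L ^ (k + 1) * N))
        ≤ (1 + 2 * (d : ℝ) * (2 * ((d : ℝ) * L) * ((2 * (d * L) + 1 : ℕ) : ℝ) ^ d)) * dirL1 Y₁ (periodBox (L ^ (k + 1) * N)) := by
  classical
  have hL1 : 1 ≤ L := by omega
  -- the frame potential in `ℓ¹` (§2), obtained before any abbreviation is introduced
  have hF := sum_norm_framePot_le (n := n) hd hL k hN hY₁P
  have hn₀1 : 1 ≤ L ^ (k + 1) := Nat.one_le_pow _ _ (by omega)
  have hn₀z : ((L ^ (k + 1) : ℕ) : ℤ) ≠ 0 := by exact_mod_cast (show L ^ (k + 1) ≠ 0 by omega)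
  have hP1 : 1 ≤ L ^ (k + 1) * N := Nat.one_le_iff_ne_zero.mpr (Nat.mul_ne_zero (by omega) (by omega))
  -- the frame potential is `N`-periodic
  have hGP : ∀ (z : Site d) (τ : Fin d), framePot L (k + 1) Y₁ (z + (N : ℤ) • e τ) = framePot L (k + 1) Y₁ z :=
    framePot_add_period L (k + 1) Y₁ (P := (N : ℤ)) (fun y τ μ => by have := hY₁P y τ μ; push_cast at this; exact this)
  -- the corner lift
  set Λ : Site d → Matrix n n ℂ :=
    fun x => if ∀ i, ((L ^ (k + 1) : ℕ) : ℤ) ∣ x i then framePot L (k + 1) Y₁ (fun i => x i / ((L ^ (k + 1) : ℕ) : ℤ)) else 0 with hΛ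
  have hΛcorner : ∀ z : Site d, Λ (((L ^ (k + 1) : ℕ) : ℤ) • z) = framePot L (k + 1) Y₁ z := by
    intro z
    have hdiv : ∀ i, ((L ^ (k + 1) : ℕ) : ℤ) ∣ ((((L ^ (k + 1) : ℕ) : ℤ)) • z) i := fun i => ⟨z i, by simp⟩
    have hLz : (L : ℤ) ^ (k + 1) ≠ 0 := pow_ne_zero _ (by exact_mod_cast (show L ≠ 0 by omega))
    simp only [hΛ]
    rw [if_pos hdiv]
    congr 1
    funext i
    simp only [Pi.smul_apply, smul_eq_mul]
    push_cast
    exact Int.mul_ediv_cancel_left (z i) hLz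
  have hΛP : ∀ (x : Site d) (τ : Fin d), Λ (x + ((L ^ (k + 1) * N : ℕ) : ℤ) • e τ) = Λ x := by
    intro x τ
    have hiff : (∀ i, ((L ^ (k + 1) : ℕ) : ℤ) ∣ (x + ((L ^ (k + 1) * N : ℕ) : ℤ) • e τ) i) ↔ ∀ i, ((L ^ (k + 1) : ℕ) : ℤ) ∣ x i := by
      refine forall_congr' fun i => ?_
      simp only [Pi.add_apply, Pi.smul_apply, smul_eq_mul, Nat.cast_mul]
      rw [show ((L ^ (k + 1) : ℕ) : ℤ) * N * e τ i = ((L ^ (k + 1) : ℕ) : ℤ) * (N * e τ i) by ring]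
      exact dvd_add_left (Dvd.intro _ rfl)
    by_cases hx : ∀ i, ((L ^ (k + 1) : ℕ) : ℤ) ∣ x i
    · have hx' := hiff.mpr hx
      simp only [hΛ]
      rw [if_pos hx, if_pos hx']
      have hq : (fun i => (x + ((L ^ (k + 1) * N : ℕ) : ℤ) • e τ) i / ((L ^ (k + 1) : ℕ) : ℤ))
          = (fun i => x i / ((L ^ (k + 1) : ℕ) : ℤ)) + (N : ℤ) • e τ := by
        funext i
        simp only [Pi.add_apply, Pi.smul_apply, smul_eq_mul, Nat.cast_mul]
        rw [show ((L ^ (k + 1) : ℕ) : ℤ) * N * e τ i = ((L ^ (k + 1) : ℕ) : ℤ) * (N * e τ i) by ring, Int.add_mul_ediv_left _ _ hn₀z]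
      rw [hq, hGP]
    · have hx' : ¬ ∀ i, ((L ^ (k + 1) : ℕ) : ℤ) ∣ (x + ((L ^ (k + 1) * N : ℕ) : ℤ) • e τ) i := fun h => hx (hiff.mp h)
      simp only [hΛ]
      rw [if_neg hx, if_neg hx']
  -- the corrected field and its skew part
  refine ⟨skewPart (Y₁ + dPot Λ), isSkewDir_skewPart _, ?_, ?_, ?_, ?_⟩
  · -- periodic
    refine isPeriodicDir_skewPart fun x κ μ => ?_
    rw [Pi.add_apply, Pi.add_apply, hY₁P x κ μ]
    congr 1
    exact dPot_add_period hΛP x κ μ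
  · -- tangent
    rw [dirIter_flat_skewPart hL1, dirIter_flat_add hL1, dirIter_flat hL1, dirIter_flat hL1, iterate_Tcoarse_eq' hL1, hQ,
      iterate_Tcoarse_dPot hL1]
    have hc : (fun w : Site d => Λ (((L : ℤ) ^ (k + 1)) • w)) = framePot L (k + 1) Y₁ := by
      funext w; rw [← hΛcorner w]; push_cast; rfl
    have hsum : ((fun z κ => (0 : Site d → Fin d → Matrix n n ℂ) z κ - dPot (framePot L (k + 1) Y₁) z κ)
        + dPot fun w => Λ (((L : ℤ) ^ (k + 1)) • w)) = 0 := by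
      rw [hc]
      funext z κ
      simp only [Pi.add_apply, Pi.zero_apply, zero_sub, neg_add_cancel]
    rw [hsum]
    funext z κ
    exact skewPartM_zero'
  · -- same curl
    intro z μ ν
    rw [curlAt_flat_skewPart, curlAt_flat_add, curlAt_flat_dPot, add_zero]
    exact skewPartM_eq_self (curlAt_mem_skewAdjoint isUnitaryCfg_flat hY₁s z μ ν)
  · -- the `ℓ¹` cost
    have hper : ∀ (x : Site d) (κ : Fin d), ‖Λ (x + ((L ^ (k + 1) * N : ℕ) : ℤ) • e κ)‖ = ‖Λ x‖ := fun x κ => by rw [hΛP x κ]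
    -- `Σ_{x∈[0,L^{k+1}N)^d} ‖Λ x‖ = Σ_{z∈[0,N)^d} ‖framePot Y₁ z‖`
    have hcorners : ∑ x ∈ periodBox (L ^ (k + 1) * N), ‖Λ x‖ = ∑ z ∈ periodBox N, ‖framePot L (k + 1) Y₁ z‖ := by
      rw [← blockSites_periodBox (L ^ (k + 1)) N hn₀1, ← sum_blocks_eq (L ^ (k + 1)) hn₀1 (periodBox N) (fun y => ‖Λ y‖)]
      refine Finset.sum_congr rfl fun z _ => ?_
      let r₀ : Fin d → Fin (L ^ (k + 1)) := fun _ => ⟨0, hn₀1⟩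
      rw [Finset.sum_eq_single r₀]
      · have hr₀ : boxVec (L ^ (k + 1)) r₀ = 0 := by funext κ; simp [boxVec, r₀]
        rw [hr₀, add_zero, hΛcorner z]
      · intro r _ hr
        have hnd : ¬ ∀ i, ((L ^ (k + 1) : ℕ) : ℤ) ∣ (((L ^ (k + 1) : ℕ) : ℤ) • z + boxVec (L ^ (k + 1)) r) i := by
          intro hall
          apply hr
          funext i
          have hi := hall i
          simp only [Pi.add_apply, Pi.smul_apply, smul_eq_mul, boxVec] at hi
          have hri : ((L ^ (k + 1) : ℕ) : ℤ) ∣ ((r i : ℕ) : ℤ) := (dvd_add_right (Dvd.intro _ rfl)).mp hi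
          have hlt : ((r i : ℕ) : ℤ) < ((L ^ (k + 1) : ℕ) : ℤ) := by exact_mod_cast (r i).isLt
          have h0 : ((r i : ℕ) : ℤ) = 0 := by
            rcases hri with ⟨c, hc⟩
            have hc0 : c = 0 := by
              by_contra hne
              have : (1 : ℤ) ≤ c ∨ c ≤ -1 := by omega
              rcases this with h | h <;>
                nlinarith [show (0 : ℤ) ≤ ((r i : ℕ) : ℤ) by positivity, show (1 : ℤ) ≤ ((L ^ (k + 1) : ℕ) : ℤ) by exact_mod_cast hn₀1]
            rw [hc, hc0, mul_zero]
          exact Fin.ext (by exact_mod_cast h0)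
        have e1 : ((L ^ (k + 1) : ℕ) : ℤ) • z + boxVec (L ^ (k + 1)) r = (((L ^ (k + 1) : ℕ) : ℤ)) • z + boxVec (L ^ (k + 1)) r := rfl
        simp only [hΛ]
        push_cast at hnd ⊢
        rw [if_neg hnd, norm_zero]
      · intro h; exact absurd (Finset.mem_univ r₀) h
    -- the gauge in `ℓ¹`
    have hgauge : dirL1 (dPot Λ) (periodBox (d := d) (L ^ (k + 1) * N)) ≤ 2 * (d : ℝ) * ∑ z ∈ periodBox N, ‖framePot L (k + 1) Y₁ z‖ := by
      unfold dirL1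
      calc ∑ x ∈ periodBox (L ^ (k + 1) * N), ∑ κ : Fin d, ‖dPot Λ x κ‖
          ≤ ∑ x ∈ periodBox (L ^ (k + 1) * N), ∑ κ : Fin d, (‖Λ (x + e κ)‖ + ‖Λ x‖) :=
            Finset.sum_le_sum fun x _ => Finset.sum_le_sum fun κ _ => by unfold dPot; exact norm_sub_le _ _
        _ = ∑ κ : Fin d, (∑ x ∈ periodBox (L ^ (k + 1) * N), ‖Λ (x + e κ)‖ + ∑ x ∈ periodBox (L ^ (k + 1) * N), ‖Λ x‖) := by
            rw [Finset.sum_comm]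
            exact Finset.sum_congr rfl fun κ _ => Finset.sum_add_distrib
        _ = ∑ _κ : Fin d, (2 * ∑ z ∈ periodBox N, ‖framePot L (k + 1) Y₁ z‖) := by
            refine Finset.sum_congr rfl fun κ _ => ?_
            rw [sum_periodBox_shift (L ^ (k + 1) * N) hP1 (g := fun y => ‖Λ y‖) hper (e κ), hcorners]
            ring
        _ = 2 * (d : ℝ) * ∑ z ∈ periodBox N, ‖framePot L (k + 1) Y₁ z‖ := by
            rw [Finset.sum_const, Finset.card_univ, Fintype.card_fin, nsmul_eq_mul]; ring
    have hD0 : 0 ≤ dirL1 Y₁ (periodBox (d := d) (L ^ (k + 1) * N)) :=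
      Finset.sum_nonneg fun _ _ => Finset.sum_nonneg fun _ _ => norm_nonneg _
    calc dirL1 (skewPart (Y₁ + dPot Λ)) (periodBox (L ^ (k + 1) * N))
        ≤ dirL1 (Y₁ + dPot Λ) (periodBox (L ^ (k + 1) * N)) :=
          Finset.sum_le_sum fun x _ => Finset.sum_le_sum fun κ _ => norm_skewPart_le _ x κ
      _ ≤ dirL1 Y₁ (periodBox (L ^ (k + 1) * N)) + dirL1 (dPot Λ) (periodBox (L ^ (k + 1) * N)) := by
          unfold dirL1
          rw [← Finset.sum_add_distrib]
          refine Finset.sum_le_sum fun x _ => ?_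
          rw [← Finset.sum_add_distrib]
          exact Finset.sum_le_sum fun κ _ => norm_add_le _ _
      _ ≤ dirL1 Y₁ (periodBox (L ^ (k + 1) * N)) + 2 * (d : ℝ) * ((2 * ((d : ℝ) * L) * ((2 * (d * L) + 1 : ℕ) : ℝ) ^ d)
            * dirL1 Y₁ (periodBox (L ^ (k + 1) * N))) := by
          have hd0 : (0 : ℝ) ≤ 2 * (d : ℝ) := by positivity
          have hfin := hgauge.trans (mul_le_mul_of_nonneg_left hF hd0)
          linarith
      _ = (1 + 2 * (d : ℝ) * (2 * ((d : ℝ) * L) * ((2 * (d * L) + 1 : ℕ) : ℝ) ^ d)) * dirL1 Y₁ (periodBox (L ^ (k + 1) * N)) := by ring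

end

end Summit.QuantumFields.BalabanUV.T4Continuum.NE7FramePotL1
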